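import Summits.ResolutionOfSingularities.ResolutionOfSingularities.Theorems.FrobeniusLadderFInjectiveMacaulayficationNonFullLoopFloorFiveCentre
import Summits.ResolutionOfSingularities.ResolutionOfSingularities.Theorems.FrobeniusLadderFInjectiveMacaulayficationKLocCellKitOff
import Summits.ResolutionOfSingularities.ResolutionOfSingularities.Theorems.FrobeniusLadderFInjectiveMacaulayficationKLocCellOff
import Summits.ResolutionOfSingularities.ResolutionOfSingularities.Theorems.FrobeniusLadderFInjectiveMacaulayficationNonFullLoopFloorOneLocus
import Summits.ResolutionOfSingularities.ResolutionOfSingularities.Theorems.FrobeniusLadderFInjectiveMacaulayficationNonFullLoopFrame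
import HarnessLib

/-!
# NEG-N, FLOOR 5: ★★★ THE TWO-SIDED LOCUS LEMMA `hlocus` of the (L-g) frame — a point of `U₀ = Spec k[x,y,u,t,z]/(g₅)` is NON-FULL
# **iff** it lies on `V(x̄, ȳ, z̄)` (`char k = 2`)
# (crux `FInjectiveMacaulayfication` stmt-ResolutionOfSingularities-15315, chain w45a; res-L1-w45a-plan-1 g19 RULINGS R19.21 «NEG-N» / R19.22 (NEG-5 → stub-1);
# the hypothesis `hlocus` of res-L1-w45a-lead-1's `…NonFullLoopFrame` (l.81722) VERBATIM; floor table res-L1-w45a-tri-2 g16 l.81567 / FIRST-STEP PASS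
# l.81588 (`fl 5: D(x) ε = yz, g = x · D(y) ε = x, g = y · D(z) ε = 1, g = z`); seat res-L1-w45a-stub-1 g12; off-cell template = res-L1-w45a-stub-3's
# `LoopGermLCureAll.offCentre_clause` (✓ p643746) over res-L1-w45a-stub-5's `KLocCellKitOff` / `KLocCellOff`)

[OURS · L1 W4.5a] Support file (`--supports stmt-ResolutionOfSingularities-15315 --as helper`); replaces the role of NO printed item; NOT a statement of any
manuscript; def-free; UNCONDITIONAL; `CharP k 2` throughout. AI-written (AI review is weaker than expert review).

`X 0 = x`, `X 1 = y`, `X 2 = u`, `X 3 = t`, `X 4 = z`; `g₅ = X 4 ^ 2 + X 0 ^ 2 * X 1 * X 4 + X 0 * X 1 ^ 2 * X 2 ^ 3 + X 0 * X 1 ^ 2 * X 3 ^ 3 + X 0 * X 1 ^ 2`, `A = k[X]/(g₅)`,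
centre `𝔮 = (x̄, ȳ, z̄) = Ideal.span ((fun j => mk (X j)) '' ↑({0, 1, 4} : Finset (Fin 5)))`.
* §1 ★ `offCentre_clause` — `A` carries the CM + Frobenius-closed clause at every MAXIMAL ideal missing one of `x̄, ȳ, z̄`: the p-basis split
  `g₅ = 1·z² + (yz)·x² + (xu)·(yu)² + (xt)·(yt)² + x·y²` has the three OFF-cells `x² · (yz)`, `y² · (x)`, `z² · (1)` — on `D(x)`, `D(y)`, `D(z)` a split
  coefficient is a unit, so `g₅ ∉ 𝔫^{[2]}` at every maximal `𝔫` there (Fedder) — ONE `decide +kernel` over `KLocCellKit.checkKsOff` and res-L1-w45a-stub-5's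
  `KLocCellOff.honQuot_of_kLocCells_off`; `g₅_eq_evalL` (`evalL_X` from this seat's ✓ p646599 `…NonFullLoopFloorOneLocus`);
* §2 ★★ `fullCl_stalk_of_not_centre_le` — **FULL at EVERY point `w` of `U₀` off `V(𝔮)`** (closed or not): a Jacobson step picks a maximal `Q' ⊇ w` missing the
  same generator, §1 gives the clause at `Q'`, `ClauseOfMaximal.fiClause_atPrime_of_le` localizes it to `w`, `Spec.stalkIso` moves it to the stalk; the «⊆» half;
* §3 ★★★ `not_fullCl_stalk_iff_centre_le` — **`∀ w, ¬ FullCl 2 𝒪_{U₀,w} ↔ (x̄, ȳ, z̄) ≤ w`**, the type of lead-1's `hlocus` VERBATIM (§2 + `NonFullLoopFloorFiveCentre.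
  not_fullCl_stalk_of_centre_le`): the non-FULL locus of the period-one germ IS `V(x, y, z)` — reduced, two-dimensional, the N-centre that the blow-up chart
  `D(x̄ t)` reproduces verbatim (lead-1 `chart_identity_g5`). With the frame this discharges `nonFullCentre_eq`, `not_exists_nonFullTower_of_contains_U0` and the
  `hlocus` binder of `not_nonFullTowerConjecture_of_occurrence` (NEG-A assembles);
* §4 ★★★ the (L-g) receivers DISCHARGED: `nonFullCentre_eq` (`Recipes.nonFullCentre 2 U₀ = (x̄,ȳ,z̄)~`), `centre_eq`, ★★★ `not_exists_nonFullTower_of_contains_U0`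
  (NO scheme with an open copy of `U₀` has an N_red-tower of any height ending FULL — hypothesis-free), `not_exists_towerFull_of_contains_U0` (v1 twin).
[cite: Fedder1983, Prop. 1.7 and Thm. 1.12]
-/

-- single-problem summit: the doubled namespace component is forced
set_option linter.dupNamespace false

noncomputable section

open AlgebraicGeometry CategoryTheory Literature.AlgebraicGeometry.Resolution TopologicalSpace IsLocalRing MvPolynomial

namespace Summit.ResolutionOfSingularities.ResolutionOfSingularities.Theorems.FInjectiveMacaulayfication.NonFullLoopFloorFive

open Summit.ResolutionOfSingularities.ResolutionOfSingularities.Theorems.FInjectiveMacaulayfication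
open SliceableCentre IntrinsicTower.Recipes

variable (k : Type) [Field k]

/-! ## §1 `U₀` is F-pure (and CM) off `V(x̄, ȳ, z̄)`: three OFF-cells -/

/-- `g₅` is the value of its term list. [plumbing] -/
theorem g₅_eq_evalL : (X 4 ^ 2 + X 0 ^ 2 * X 1 * X 4 + X 0 * X 1 ^ 2 * X 2 ^ 3 + X 0 * X 1 ^ 2 * X 3 ^ 3 + X 0 * X 1 ^ 2 : MvPolynomial (Fin 5) k) =
    KLocCellKit.evalL k [((1 : ℤ), ![0, 0, 0, 0, 2]), ((1 : ℤ), ![2, 1, 0, 0, 1]), ((1 : ℤ), ![1, 2, 3, 0, 0]), ((1 : ℤ), ![1, 2, 0, 3, 0]), ((1 : ℤ), ![1, 2, 0, 0, 0])] := by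
  simp only [KLocCellKit.evalL, List.map_cons, List.map_nil, List.sum_cons, List.sum_nil, Int.cast_one, PConeFedderData.monomial_five]
  ring

set_option maxHeartbeats 800000 in
-- one kernel `decide` for the three off-cells + the off-cell engine
/-- ★ **`U₀` OFF THE CENTRE**: `k[X]/(g₅)` satisfies the CM + Frobenius-closed clause at every maximal ideal missing one of `x̄, ȳ, z̄` (`char k = 2`). The three
OFF-cells `x² · yz`, `y² · x`, `z² · 1` are terms of the p-basis split of `g₅` with coefficients `x², y², z²` — so `h² ∈ (split coefficients)` for `h = x, y, z`
(Fedder: `g₅ ∉ 𝔫^{[2]}` when `h ∉ 𝔫`; tri-2 l.81588 fl 5). NOT claimed at maximal ideals containing `(x̄, ȳ, z̄)` (false there: `NonFullLoopFloorFiveCentre`).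
[cite: Fedder1983, Prop. 1.7, Thm. 1.12] -/
theorem offCentre_clause [CharP k 2] (g : MvPolynomial (Fin 5) k) (hg : g = X 4 ^ 2 + X 0 ^ 2 * X 1 * X 4 + X 0 * X 1 ^ 2 * X 2 ^ 3 + X 0 * X 1 ^ 2 * X 3 ^ 3 + X 0 * X 1 ^ 2)
    (Q' : Ideal (MvPolynomial (Fin 5) k ⧸ Ideal.span {g})) [Q'.IsMaximal]
    (hQ' : ∃ j ∈ ({0, 1, 4} : Finset (Fin 5)), Ideal.Quotient.mk (Ideal.span {g}) (X j) ∉ Q') :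
    ∀ d : ℕ, ringKrullDim (Localization.AtPrime Q') = d → ∀ s : Fin d → Localization.AtPrime Q',
      (Ideal.span (Set.range s)).radical.IsMaximal →
        RingTheory.Sequence.IsWeaklyRegular (Localization.AtPrime Q') (List.ofFn s) ∧
        ∀ y : Localization.AtPrime Q', (∃ n : ℕ, y ^ 2 ^ n ∈ Ideal.span
          ((fun z : Localization.AtPrime Q' => z ^ 2 ^ n) '' (Ideal.span (Set.range s) : Set (Localization.AtPrime Q')))) → y ∈ Ideal.span (Set.range s) := by
  classical
  haveI : Fact (Nat.Prime 2) := ⟨Nat.prime_two⟩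
  have hL := g₅_eq_evalL k
  have hg0' := g₅_ne_zero k g hg
  have hX' := not_X_dvd_g₅ k g hg
  have hf' : g = KLocCellKit.evalL k [((1 : ℤ), ![0, 0, 0, 0, 2]), ((1 : ℤ), ![2, 1, 0, 0, 1]), ((1 : ℤ), ![1, 2, 3, 0, 0]), ((1 : ℤ), ![1, 2, 0, 3, 0]), ((1 : ℤ), ![1, 2, 0, 0, 0])] :=
    hg.trans hL
  subst hf'
  have hcellsOff := KLocCellKit.offCells_of_check (K := k) 2
    [((1 : ℤ), ![0, 0, 0, 0, 2]), ((1 : ℤ), ![2, 1, 0, 0, 1]), ((1 : ℤ), ![1, 2, 3, 0, 0]), ((1 : ℤ), ![1, 2, 0, 3, 0]), ((1 : ℤ), ![1, 2, 0, 0, 0])]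
    [(∅ : Finset (Fin 5))]
    [[((1 : ℤ), (Pi.single 0 1 : Fin 5 → ℕ))], [((1 : ℤ), (Pi.single 1 1 : Fin 5 → ℕ))], [((1 : ℤ), (Pi.single 4 1 : Fin 5 → ℕ))]]
    [((∅ : Finset (Fin 5)), [(![0, 1, 0, 0, 1], [((1 : ℤ), ![0, 0, 0, 0, 0])])], (fun _ => []), [], [((1 : ℤ), (Pi.single 0 1 : Fin 5 → ℕ))], 2),
      ((∅ : Finset (Fin 5)), [(![1, 0, 0, 0, 0], [((1 : ℤ), ![0, 0, 0, 0, 0])])], (fun _ => []), [], [((1 : ℤ), (Pi.single 1 1 : Fin 5 → ℕ))], 2),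
      ((∅ : Finset (Fin 5)), [(![0, 0, 0, 0, 0], [((1 : ℤ), ![0, 0, 0, 0, 0])])], (fun _ => []), [], [((1 : ℤ), (Pi.single 4 1 : Fin 5 → ℕ))], 2)]
    (by decide +kernel) (by decide)
  have H := KLocCellOff.honQuot_of_kLocCells_off 2 k 5 (∅ : Finset (Fin 5)) (1 : Matrix (Fin 5) (Fin 5) ℕ)
    (KLocCellKit.evalL k [((1 : ℤ), ![0, 0, 0, 0, 2]), ((1 : ℤ), ![2, 1, 0, 0, 1]), ((1 : ℤ), ![1, 2, 3, 0, 0]), ((1 : ℤ), ![1, 2, 0, 3, 0]), ((1 : ℤ), ![1, 2, 0, 0, 0])])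
    hg0' hX' [] [(∅ : Finset (Fin 5))]
    (([[((1 : ℤ), (Pi.single 0 1 : Fin 5 → ℕ))], [((1 : ℤ), (Pi.single 1 1 : Fin 5 → ℕ))], [((1 : ℤ), (Pi.single 4 1 : Fin 5 → ℕ))]] :
      List (List (ℤ × (Fin 5 → ℕ)))).map (KLocCellKit.evalL k))
    (fun T _ => Or.inr ⟨∅, by simp, Finset.empty_subset T⟩) (by simp) hcellsOff Q' (by simp) ?_
  · exact H.2
  · obtain ⟨j, hj, hjQ⟩ := hQ'
    simp only [Finset.mem_insert, Finset.mem_singleton] at hj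
    rcases hj with rfl | rfl | rfl
    · exact ⟨_, List.mem_map.mpr ⟨_, by simp, NonFullLoopFloorOne.evalL_X k 0⟩, hjQ⟩
    · exact ⟨_, List.mem_map.mpr ⟨_, by simp, NonFullLoopFloorOne.evalL_X k 1⟩, hjQ⟩
    · exact ⟨_, List.mem_map.mpr ⟨_, by simp, NonFullLoopFloorOne.evalL_X k 4⟩, hjQ⟩

/-! ## §2 ★★ FULL at every point off `V(x̄, ȳ, z̄)` (the «⊆» half of `hlocus`) -/

/-- ★★ **`FullCl 2 (A_P)` at EVERY prime `P ⊉ (x̄, ȳ, z̄)`** (`char k = 2`): a maximal `Q' ⊇ P` missing the same generator exists (`A` is Jacobson), §1 gives the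
clause at `Q'`, and the clause (with `IsDomain`) localizes from `Q'` to `P` (`ClauseOfMaximal.fiClause_atPrime_of_le`). [OURS · certificate; cite: Fedder1983, Thm. 1.12] -/
theorem fullCl_localization_of_not_centre_le [CharP k 2] (g : MvPolynomial (Fin 5) k)
    (hg : g = X 4 ^ 2 + X 0 ^ 2 * X 1 * X 4 + X 0 * X 1 ^ 2 * X 2 ^ 3 + X 0 * X 1 ^ 2 * X 3 ^ 3 + X 0 * X 1 ^ 2)
    (P : Ideal (MvPolynomial (Fin 5) k ⧸ Ideal.span {g})) [P.IsPrime]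
    (hP : ¬ Ideal.span ((fun j : Fin 5 => Ideal.Quotient.mk (Ideal.span {g}) (X j)) '' (({0, 1, 4} : Finset (Fin 5)) : Set (Fin 5))) ≤ P) :
    FullCl 2 (Localization.AtPrime P) := by
  haveI : Fact (Nat.Prime 2) := ⟨Nat.prime_two⟩
  haveI := NonFullLoopFrame.isPrime_span_g5 k g hg
  haveI : IsDomain (MvPolynomial (Fin 5) k ⧸ Ideal.span {g}) := Ideal.Quotient.isDomain _
  haveI : CharP (MvPolynomial (Fin 5) k ⧸ Ideal.span {g}) 2 := charP_of_injective_algebraMap (algebraMap k _).injective 2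
  -- a generator outside `P`
  have hex : ∃ j ∈ ({0, 1, 4} : Finset (Fin 5)), Ideal.Quotient.mk (Ideal.span {g}) (X j) ∉ P := by
    by_contra hcon
    push Not at hcon
    exact hP (Ideal.span_le.mpr (by rintro _ ⟨j, hj, rfl⟩; exact hcon j hj))
  obtain ⟨j, hj, hjP⟩ := hex
  -- Jacobson: a maximal ideal `Q' ⊇ P` missing the same generator
  have hJ : P.jacobson = P := IsJacobsonRing.out inferInstance (Ideal.IsPrime.isRadical ‹_›)
  have hexQ : ∃ Q' : Ideal (MvPolynomial (Fin 5) k ⧸ Ideal.span {g}), Q'.IsMaximal ∧ P ≤ Q' ∧ Ideal.Quotient.mk (Ideal.span {g}) (X j) ∉ Q' := by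
    by_contra hcon
    push Not at hcon
    apply hjP
    rw [← hJ, Ideal.jacobson, Ideal.mem_sInf]
    rintro Q ⟨hPQ, hQ⟩
    exact hcon Q hQ hPQ
  obtain ⟨Q', hQ'max, hPQ', hjQ'⟩ := hexQ
  exact ClauseOfMaximal.fiClause_atPrime_of_le 2 hPQ' ⟨inferInstance, offCentre_clause k g hg Q' ⟨j, hj, hjQ'⟩⟩

/-- ★★ **THE «⊆» HALF OF THE FLOOR-5 LOCUS LEMMA** (stalk form, lead-1's letters): every point `w` of `U₀` with `¬ (x̄, ȳ, z̄) ≤ w` is FULL (`char k = 2`).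
[OURS · certificate] -/
theorem fullCl_stalk_of_not_centre_le [CharP k 2] (g : MvPolynomial (Fin 5) k)
    (hg : g = X 4 ^ 2 + X 0 ^ 2 * X 1 * X 4 + X 0 * X 1 ^ 2 * X 2 ^ 3 + X 0 * X 1 ^ 2 * X 3 ^ 3 + X 0 * X 1 ^ 2)
    (w : Spec (.of (MvPolynomial (Fin 5) k ⧸ Ideal.span {g})))
    (hw : ¬ Ideal.span ((fun j : Fin 5 => Ideal.Quotient.mk (Ideal.span {g}) (X j)) '' (({0, 1, 4} : Finset (Fin 5)) : Set (Fin 5))) ≤ w.asIdeal) :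
    FullCl 2 ((Spec (.of (MvPolynomial (Fin 5) k ⧸ Ideal.span {g}))).presheaf.stalk w) :=
  WFixAtNonClosedDimTwo.fullCl_of_ringEquiv 2 (Spec.stalkIso (.of _) w).commRingCatIsoToRingEquiv.symm
    (fullCl_localization_of_not_centre_le k g hg w.asIdeal hw)

/-! ## §3 ★★★ The two-sided locus lemma `hlocus` -/

/-- ★★★ **THE FLOOR-5 LOCUS LEMMA, BOTH SIDES** — the hypothesis `hlocus` of res-L1-w45a-lead-1's (L-g) frame `…NonFullLoopFrame` VERBATIM: for `U₀ = Spec k[X]/(g₅)`,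
`g₅ = z² + x²yz + xy²(u³+t³+1)`, `char k = 2`, a point `w` is NON-FULL **iff** `(x̄, ȳ, z̄) ≤ w`. So the non-FULL locus (= the non-F-pure locus; every
point is CM) of the period-one N-loop germ is the reduced surface `V(x, y, z) ≅ 𝔸²_{u,t}`, i.e. the N-centre `Recipes.nonFullCentre 2 U₀ = (x̄, ȳ, z̄)~`
(lead-1 `nonFullCentre_eq`), whose blow-up chart `D(x̄ t)` is `U₀` again. [OURS · certificate; cite: Fedder1983, Prop. 1.7 and Thm. 1.12] -/
theorem not_fullCl_stalk_iff_centre_le [CharP k 2] (g : MvPolynomial (Fin 5) k)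
    (hg : g = X 4 ^ 2 + X 0 ^ 2 * X 1 * X 4 + X 0 * X 1 ^ 2 * X 2 ^ 3 + X 0 * X 1 ^ 2 * X 3 ^ 3 + X 0 * X 1 ^ 2) :
    ∀ w : Spec (.of (MvPolynomial (Fin 5) k ⧸ Ideal.span {g})),
      ¬ FullCl 2 ((Spec (.of (MvPolynomial (Fin 5) k ⧸ Ideal.span {g}))).presheaf.stalk w) ↔
        Ideal.span ((fun j : Fin 5 => Ideal.Quotient.mk (Ideal.span {g}) (X j)) '' (({0, 1, 4} : Finset (Fin 5)) : Set (Fin 5))) ≤ w.asIdeal :=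
  fun w => ⟨fun h => by_contra fun hw => h (fullCl_stalk_of_not_centre_le k g hg w hw), fun hw => not_fullCl_stalk_of_centre_le k g hg w hw⟩

/-- The same in localization form: `¬ FullCl 2 (A_P) ↔ (x̄, ȳ, z̄) ≤ P` for every prime `P` of `A = k[X]/(g₅)`. [OURS · certificate] -/
theorem not_fullCl_localization_iff_centre_le [CharP k 2] (g : MvPolynomial (Fin 5) k)
    (hg : g = X 4 ^ 2 + X 0 ^ 2 * X 1 * X 4 + X 0 * X 1 ^ 2 * X 2 ^ 3 + X 0 * X 1 ^ 2 * X 3 ^ 3 + X 0 * X 1 ^ 2)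
    (P : Ideal (MvPolynomial (Fin 5) k ⧸ Ideal.span {g})) [P.IsPrime] :
    ¬ FullCl 2 (Localization.AtPrime P) ↔
      Ideal.span ((fun j : Fin 5 => Ideal.Quotient.mk (Ideal.span {g}) (X j)) '' (({0, 1, 4} : Finset (Fin 5)) : Set (Fin 5))) ≤ P :=
  ⟨fun h => by_contra fun hP => h (fullCl_localization_of_not_centre_le k g hg P hP), fun hP => not_fullCl_localization_of_centre_le k g hg P hP⟩

/-! ## §4 ★★★ res-L1-w45a-lead-1's (L-g) receivers at `U₀`, DISCHARGED (hypothesis-free) -/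

/-- ★★ **`Recipes.nonFullCentre 2 U₀ = (x̄, ȳ, z̄)~`** — lead-1's `NonFullLoopFrame.nonFullCentre_eq` with its locus hypothesis discharged by §3: the N-centre of the
period-one germ IS the ideal sheaf of `V(x, y, z)`. [OURS · unconditional] -/
theorem nonFullCentre_eq [CharP k 2] (g : MvPolynomial (Fin 5) k)
    (hg : g = X 4 ^ 2 + X 0 ^ 2 * X 1 * X 4 + X 0 * X 1 ^ 2 * X 2 ^ 3 + X 0 * X 1 ^ 2 * X 3 ^ 3 + X 0 * X 1 ^ 2) :
    nonFullCentre 2 (Spec (.of (MvPolynomial (Fin 5) k ⧸ Ideal.span {g}))) =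
      affineBlowup.idealSheaf (Ideal.span ((fun j : Fin 5 => Ideal.Quotient.mk (Ideal.span {g}) (X j)) '' (({0, 1, 4} : Finset (Fin 5)) : Set (Fin 5)))) :=
  NonFullLoopFrame.nonFullCentre_eq k g hg (not_fullCl_stalk_iff_centre_le k g hg)

/-- The v1 intrinsic centre, discharged: `IntrinsicTower.centre 2 U₀ = (x̄, ȳ, z̄)~`. [OURS · unconditional] -/
theorem centre_eq [CharP k 2] (g : MvPolynomial (Fin 5) k)
    (hg : g = X 4 ^ 2 + X 0 ^ 2 * X 1 * X 4 + X 0 * X 1 ^ 2 * X 2 ^ 3 + X 0 * X 1 ^ 2 * X 3 ^ 3 + X 0 * X 1 ^ 2) :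
    IntrinsicTower.centre 2 (Spec (.of (MvPolynomial (Fin 5) k ⧸ Ideal.span {g}))) =
      affineBlowup.idealSheaf (Ideal.span ((fun j : Fin 5 => Ideal.Quotient.mk (Ideal.span {g}) (X j)) '' (({0, 1, 4} : Finset (Fin 5)) : Set (Fin 5)))) :=
  NonFullLoopFrame.centre_eq k g hg (not_fullCl_stalk_iff_centre_le k g hg)

/-- ★★★ **THE N-RECIPE RECEIVER AT `U₀`, HYPOTHESIS-FREE**: NO scheme containing an open copy of the period-one germ `U₀ = Spec k[X]/(g₅)` (`char k = 2`) admits an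
`N_red`-tower (`Recipes.nonFullCentre`) of ANY height ending FULL — lead-1's `NonFullLoopFrame.not_exists_nonFullTower_of_contains_U0` with `hlocus` discharged by §3.
(The link from here to `¬ NonFullTowerConjecture` needs the GLOBAL/LOCAL floor data NEG-0 ∘ NEG-T, NEG-1…4 — R19.23; not claimed here.) [OURS · unconditional] -/
theorem not_exists_nonFullTower_of_contains_U0 [CharP k 2] (g : MvPolynomial (Fin 5) k)
    (hg : g = X 4 ^ 2 + X 0 ^ 2 * X 1 * X 4 + X 0 * X 1 ^ 2 * X 2 ^ 3 + X 0 * X 1 ^ 2 * X 3 ^ 3 + X 0 * X 1 ^ 2)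
    (S : Scheme.{0}) (hS : ∃ j : Spec (.of (MvPolynomial (Fin 5) k ⧸ Ideal.span {g})) ⟶ S, IsOpenImmersion j) :
    ¬ ∃ n : ℕ, RecipeTowerFull nonFullCentre 2 n S :=
  NonFullLoopFrame.not_exists_nonFullTower_of_contains_U0 k g hg (not_fullCl_stalk_iff_centre_le k g hg) S hS

/-- The v1 twin, hypothesis-free: NO scheme containing an open copy of `U₀` has an intrinsic tower `IntrinsicTower.TowerFull 2 n` of any height. [OURS · unconditional] -/
theorem not_exists_towerFull_of_contains_U0 [CharP k 2] (g : MvPolynomial (Fin 5) k)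
    (hg : g = X 4 ^ 2 + X 0 ^ 2 * X 1 * X 4 + X 0 * X 1 ^ 2 * X 2 ^ 3 + X 0 * X 1 ^ 2 * X 3 ^ 3 + X 0 * X 1 ^ 2)
    (S : Scheme.{0}) (hS : ∃ j : Spec (.of (MvPolynomial (Fin 5) k ⧸ Ideal.span {g})) ⟶ S, IsOpenImmersion j) :
    ¬ ∃ n : ℕ, IntrinsicTower.TowerFull 2 n S :=
  NonFullLoopFrame.not_exists_towerFull_of_contains_U0 k g hg (not_fullCl_stalk_iff_centre_le k g hg) S hS

end Summit.ResolutionOfSingularities.ResolutionOfSingularities.Theorems.FInjectiveMacaulayfication.NonFullLoopFloorFive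

end
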